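import Literature.NumberTheory.Sieve.RoughNumbersBuchstabIdentity
import Literature.NumberTheory.Sieve.ParityWave0Proofs
import HarnessLib

/-!
# Rough numbers in residue classes: the range `√x ≤ y ≤ x` (classes of primes)

Topic `Literature/NumberTheory/Sieve`. Everything here is PROVED (no definitions, no named facts).
With `Φ(x, y; q, c) = #((roughIcc ⌈y⌉₊ ⌊x⌋₊).filter (· ≡ c [MOD q]))`
`= #{1 ≤ m ≤ x : m ≡ c (mod q), p ∣ m ⇒ p ≥ y}` (sub-namespace `RoughAP`):

* `abs_card_filter_sub_le_abs_add_two` — for `X ≤ N²` the classes of `roughIcc N X` are the classes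
  of the primes in `[N, X]` up to `2` elements (`card_roughIcc_le_two_add_card_primes`);
* `card_primes_Icc_filter_add` — primes of a class in `[N, X]` through `π(X; q, c) − π(N − 1; q, c)`
  (`ParityWave0.primeCountingMod`);
* `exists_forall_abs_primeCountingMod_sub_le` — the prime number theorem in arithmetic
  progressions in DIFFERENCE form: `|π(N; q, c) − π(N; q, c')| ≤ ε N/log N` for `N ≥ n₀(q, ε)` and
  all reduced `c, c'` (from the PROVED `tendsto_primeCountingMod_mul_log_div`,
  `ParityWave0Proofs.lean`);
* `exists_forall_log_le_mul` — `log t ≤ δ t` for large `t`;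
* `abs_card_filter_sub_le_base` — **the base of the Buchstab induction**: for every `ε > 0`,
  eventually in `x`, `|Φ(x, y; q, c) − Φ(x, y; q, c')| ≤ ε x/log y` for `√x ≤ y ≤ x` and all reduced
  `c, c'` (the `y`-rough integers `≤ x ≤ y²` are `1`, the primes of `[y, x]` and at most one more).

Used by `RoughNumbersClassesEquidistribution.lean`.

## References

* H. L. Montgomery, R. C. Vaughan, *Multiplicative Number Theory I*, CUP 2007, Cor. 11.20 (prime
  number theorem in arithmetic progressions). [MontgomeryVaughan2007]
* G. Tenenbaum, *Introduction to analytic and probabilistic number theory*, 3rd ed., AMS GSM 163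
  (2015), Ch. III.6. [Tenenbaum2015]
-/

open Finset Filter
open scoped Topology

noncomputable section

namespace Literature.NumberTheory.Sieve

namespace RoughAP

/-! ### The range `X ≤ N²`: classes of primes -/

/-- For `X ≤ N²` the rough numbers in a class are the primes of `[N, X]` in that class up to at most
`2` further elements (`1` and possibly `N² = X`), so the difference of two class counts of
`roughIcc N X` is that of the primes up to `2`. [folklore] -/
theorem abs_card_filter_sub_le_abs_add_two {q N X : ℕ} (hXN : X ≤ N * N) (c c' : ℕ) :
    |(#((roughIcc N X).filter (· ≡ c [MOD q])) : ℝ) - #((roughIcc N X).filter (· ≡ c' [MOD q]))| ≤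
      |(#(((Icc N X).filter Nat.Prime).filter (· ≡ c [MOD q])) : ℝ) -
          #(((Icc N X).filter Nat.Prime).filter (· ≡ c' [MOD q]))| + 2 := by
  classical
  set R := roughIcc N X with hR
  set T := (Icc N X).filter Nat.Prime with hT
  have hTR : T ⊆ R := fun p hp => by
    rw [hT, mem_filter, mem_Icc] at hp
    exact prime_mem_roughIcc hp.2 hp.1.1 hp.1.2
  have hsplit : ∀ a : ℕ, #(R.filter (· ≡ a [MOD q])) =
      #(T.filter (· ≡ a [MOD q])) + #((R \ T).filter (· ≡ a [MOD q])) := by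
    intro a
    rw [← card_union_of_disjoint (disjoint_filter_filter disjoint_sdiff), ← filter_union,
      union_sdiff_of_subset hTR]
  have hsmall : ∀ a : ℕ, (#((R \ T).filter (· ≡ a [MOD q])) : ℝ) ≤ 2 := by
    intro a
    have h1 : #((R \ T).filter (· ≡ a [MOD q])) ≤ #(R \ T) := card_filter_le _ _
    have h2 : #(R \ T) = #R - #T := card_sdiff_of_subset hTR
    have h3 : #R ≤ 2 + #T := card_roughIcc_le_two_add_card_primes hXN
    have : #((R \ T).filter (· ≡ a [MOD q])) ≤ 2 := by omega
    exact_mod_cast this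
  rw [hsplit c, hsplit c']
  push_cast
  have hB := hsmall c
  have hB' := hsmall c'
  have hB0 : (0 : ℝ) ≤ #((R \ T).filter (· ≡ c [MOD q])) := Nat.cast_nonneg _
  have hB0' : (0 : ℝ) ≤ #((R \ T).filter (· ≡ c' [MOD q])) := Nat.cast_nonneg _
  have key : ∀ A A' B B' : ℝ, 0 ≤ B → B ≤ 2 → 0 ≤ B' → B' ≤ 2 →
      |A + B - (A' + B')| ≤ |A - A'| + 2 := by
    intro A A' B B' h0 h2 h0' h2'
    have e : A + B - (A' + B') = (A - A') + (B - B') := by ring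
    rw [e]
    refine (abs_add_le _ _).trans ?_
    have : |B - B'| ≤ 2 := by rw [abs_le]; constructor <;> linarith
    linarith
  exact key _ _ _ _ hB0 hB hB0' hB'

/-- Primes of a class in `[N, X]` and `π(·; q, c)`: for `1 ≤ N ≤ X + 1`,
`#{p ∈ [N, X] prime : p ≡ c (q)} + π(N − 1; q, c) = π(X; q, c)`. [folklore] -/
theorem card_primes_Icc_filter_add {q c N X : ℕ} (hN : 1 ≤ N) (hNX : N ≤ X + 1) :
    #(((Icc N X).filter Nat.Prime).filter (· ≡ c [MOD q])) +
        ParityWave0.primeCountingMod q c (N - 1) = ParityWave0.primeCountingMod q c X := by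
  unfold ParityWave0.primeCountingMod
  rw [filter_filter, Nat.sub_add_cancel hN, add_comm, range_eq_Ico, range_eq_Ico,
    ← Finset.Ico_add_one_right_eq_Icc, ← card_union_of_disjoint, ← filter_union,
    Finset.Ico_union_Ico_eq_Ico (Nat.zero_le N) hNX]
  exact disjoint_filter_filter (Finset.Ico_disjoint_Ico_consecutive 0 N (X + 1))

/-- `π(N; q, c)` only depends on `c mod q`. [folklore] -/
theorem primeCountingMod_mod (q c N : ℕ) :
    ParityWave0.primeCountingMod q (c % q) N = ParityWave0.primeCountingMod q c N := by
  unfold ParityWave0.primeCountingMod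
  congr 1
  refine filter_congr fun p _ => ?_
  have h : c % q ≡ c [MOD q] := Nat.mod_modEq c q
  exact and_congr_right fun _ => ⟨fun h1 => h1.trans h, fun h1 => h1.trans h.symm⟩

/-- **The prime number theorem in arithmetic progressions, difference form**: for `q ≥ 1` and
`ε > 0` there is `n₀` with `|π(N; q, c) − π(N; q, c')| ≤ ε N/log N` for all `N ≥ n₀` and all
`c, c'` prime to `q` (from `π(N; q, c) log N/N → 1/φ(q)`, the PROVED
`tendsto_primeCountingMod_mul_log_div`; uniformity in the classes because there are `φ(q)²` pairs
of classes). [cite: MontgomeryVaughan2007, Cor. 11.20 (11.33)] -/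
theorem exists_forall_abs_primeCountingMod_sub_le {q : ℕ} (hq : 0 < q) {ε : ℝ} (hε : 0 < ε) :
    ∃ n₀ : ℕ, ∀ N : ℕ, n₀ ≤ N → ∀ c c' : ℕ, c.Coprime q → c'.Coprime q →
      |(ParityWave0.primeCountingMod q c N : ℝ) - ParityWave0.primeCountingMod q c' N| ≤
        ε * N / Real.log N := by
  -- one pair of reduced classes
  have hpair : ∀ c c' : ℕ, c.Coprime q → c'.Coprime q → ∀ᶠ N : ℕ in atTop,
      |(ParityWave0.primeCountingMod q c N : ℝ) - ParityWave0.primeCountingMod q c' N| ≤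
        ε * N / Real.log N := by
    intro c c' hc hc'
    have h := (tendsto_primeCountingMod_mul_log_div hq.ne' hc).sub
      (tendsto_primeCountingMod_mul_log_div hq.ne' hc')
    rw [sub_self] at h
    filter_upwards [(Metric.tendsto_nhds.mp h) ε hε, eventually_ge_atTop 2] with N hN hN2
    have hN0 : (0 : ℝ) < N := by positivity
    have hlog : 0 < Real.log N := Real.log_pos (by exact_mod_cast hN2)
    have hq0 : 0 < Real.log N / N := div_pos hlog hN0
    rw [Real.dist_eq, sub_zero] at hN
    have e : (ParityWave0.primeCountingMod q c N : ℝ) * Real.log N / N -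
        ParityWave0.primeCountingMod q c' N * Real.log N / N =
        ((ParityWave0.primeCountingMod q c N : ℝ) - ParityWave0.primeCountingMod q c' N) *
          (Real.log N / N) := by ring
    rw [e, abs_mul, abs_of_pos hq0, ← lt_div_iff₀ hq0] at hN
    refine hN.le.trans (le_of_eq ?_)
    field_simp
  -- all pairs of reduced classes below `q` at once
  have hall : ∀ᶠ N : ℕ in atTop, ∀ c ∈ range q, ∀ c' ∈ range q, c.Coprime q → c'.Coprime q →
      |(ParityWave0.primeCountingMod q c N : ℝ) - ParityWave0.primeCountingMod q c' N| ≤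
        ε * N / Real.log N := by
    refine (eventually_all_finset _).mpr fun c _ => (eventually_all_finset _).mpr fun c' _ => ?_
    by_cases hc : c.Coprime q
    · by_cases hc' : c'.Coprime q
      · filter_upwards [hpair c c' hc hc'] with N hN _ _ using hN
      · exact Eventually.of_forall fun N _ h => absurd h hc'
    · exact Eventually.of_forall fun N h => absurd h hc
  obtain ⟨n₀, hn₀⟩ := eventually_atTop.mp hall
  refine ⟨n₀, fun N hN c c' hc hc' => ?_⟩
  have h := hn₀ N hN (c % q) (mem_range.mpr (Nat.mod_lt c hq)) (c' % q)
    (mem_range.mpr (Nat.mod_lt c' hq))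
    (by rw [Nat.Coprime, ← Nat.gcd_rec, Nat.gcd_comm]; exact Nat.Coprime.gcd_eq_one hc)
    (by rw [Nat.Coprime, ← Nat.gcd_rec, Nat.gcd_comm]; exact Nat.Coprime.gcd_eq_one hc')
  rwa [primeCountingMod_mod, primeCountingMod_mod] at h

/-! ### The base of the induction: `√x ≤ y ≤ x` -/

/-- `log t ≤ δ t` for `t ≥ t₁(δ)` (`log = o(id)`). [folklore] -/
theorem exists_forall_log_le_mul {δ : ℝ} (hδ : 0 < δ) : ∃ t₁ : ℝ, ∀ t : ℝ, t₁ ≤ t → Real.log t ≤ δ * t := by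
  have h := (Real.isLittleO_log_id_atTop.def hδ)
  obtain ⟨t₁, ht₁⟩ := eventually_atTop.mp h
  refine ⟨max t₁ 1, fun t ht => ?_⟩
  have h1 := ht₁ t ((le_max_left _ _).trans ht)
  have ht0 : 0 ≤ t := le_trans (by positivity) ((le_max_right _ _).trans ht)
  rw [id, Real.norm_of_nonneg (Real.log_nonneg ((le_max_right _ _).trans ht)),
    Real.norm_of_nonneg ht0] at h1
  exact h1

/-- **The base case `n = 2`.** For `q ≥ 1` and `ε > 0` there is `x₀` with
`|Φ(x, y; q, c) − Φ(x, y; q, c')| ≤ ε x/log y` for all `x ≥ x₀`, `2 ≤ y ≤ x` with `log x ≤ 2 log y`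
and all reduced `c, c'`: the `y`-rough integers `≤ x ≤ y²` are `1`, the primes of `[y, x]` and at most
one more (`RoughAP.abs_card_filter_sub_le_abs_add_two`), and
`|π(t; q, c) − π(t; q, c')| ≤ (ε/4) t/log t` at `t = ⌊x⌋` and `t = ⌈y⌉ − 1`
(`RoughAP.exists_forall_abs_primeCountingMod_sub_le`). [folklore] -/
theorem abs_card_filter_sub_le_base {q : ℕ} (hq : 0 < q) {ε : ℝ} (hε : 0 < ε) :
    ∃ X₀ : ℝ, ∀ X Y : ℝ, X₀ ≤ X → 2 ≤ Y → Y ≤ X → Real.log X ≤ 2 * Real.log Y → (q : ℝ) < Y →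
      ∀ c c' : ℕ, c.Coprime q → c'.Coprime q →
        |(#((roughIcc ⌈Y⌉₊ ⌊X⌋₊).filter (· ≡ c [MOD q])) : ℝ) -
            #((roughIcc ⌈Y⌉₊ ⌊X⌋₊).filter (· ≡ c' [MOD q]))| ≤ ε * X / Real.log Y := by
  obtain ⟨n₀, hn₀⟩ := exists_forall_abs_primeCountingMod_sub_le hq (ε := ε / 4) (by positivity)
  obtain ⟨t₁, ht₁⟩ := exists_forall_log_le_mul (δ := ε / 4) (by positivity)
  -- `t ↦ t/log t` is monotone on `[e, ∞)` (`Real.log_div_self_antitoneOn`; cf. `BFI.div_log_mono`)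
  have hmono : ∀ s t : ℝ, Real.exp 1 ≤ s → s ≤ t → s / Real.log s ≤ t / Real.log t := by
    intro s t hs hst
    have hs0 : 0 < s := (Real.exp_pos 1).trans_le hs
    have ht0 : 0 < t := hs0.trans_le hst
    have hls : 1 ≤ Real.log s := by rw [Real.le_log_iff_exp_le hs0]; exact hs
    have hlt : 1 ≤ Real.log t := hls.trans (Real.log_le_log hs0 hst)
    have h : Real.log t / t ≤ Real.log s / s :=
      Real.log_div_self_antitoneOn (Set.mem_Ici.mpr hs) (Set.mem_Ici.mpr (hs.trans hst)) hst
    rw [div_le_div_iff₀ ht0 hs0] at h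
    rw [div_le_div_iff₀ (by linarith) (by linarith)]
    linarith
  set s : ℝ := max (max ((n₀ : ℝ) + 4) t₁) 4 with hs_def
  have hs0 : 0 ≤ s := le_trans (by norm_num) (le_max_right _ _)
  refine ⟨s ^ 2, fun X Y hX hY2 hYX hlog _hqY c c' hc hc' => ?_⟩
  have hy0 : 0 < Y := by linarith
  have hx0 : 0 < X := by linarith
  have hly : 0 < Real.log Y := Real.log_pos (by linarith)
  -- `X ≤ Y²`, so `Y ≥ s`
  have hXY2 : X ≤ Y ^ 2 := by
    have h : Real.log X ≤ Real.log (Y ^ 2) := by rw [Real.log_pow]; push_cast; linarith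
    exact (Real.log_le_log_iff hx0 (by positivity)).mp h
  have hsY : s ≤ Y := by
    have h : s ^ 2 ≤ Y ^ 2 := hX.trans hXY2
    exact (pow_le_pow_iff_left₀ hs0 hy0.le two_ne_zero).mp h
  have hYn : (n₀ : ℝ) + 4 ≤ Y := le_trans (le_trans (le_max_left _ _) (le_max_left _ _)) hsY
  have hYt : t₁ ≤ Y := le_trans (le_trans (le_max_right _ _) (le_max_left _ _)) hsY
  have hY4 : 4 ≤ Y := le_trans (le_max_right _ _) hsY
  -- the integers `N = ⌈Y⌉`, `XX = ⌊X⌋`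
  set N := ⌈Y⌉₊ with hN
  set XX := ⌊X⌋₊ with hXX
  have hYN : Y ≤ N := Nat.le_ceil Y
  have hNY : (N : ℝ) < Y + 1 := Nat.ceil_lt_add_one hy0.le
  have hXXX : (XX : ℝ) ≤ X := Nat.floor_le hx0.le
  have hXXX' : X < XX + 1 := Nat.lt_floor_add_one X
  have hN1 : 1 ≤ N := by
    have : (1 : ℝ) ≤ N := by linarith
    exact_mod_cast this
  have hNn : n₀ + 4 ≤ N := by
    have : ((n₀ + 4 : ℕ) : ℝ) ≤ N := by push_cast; linarith
    exact_mod_cast this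
  have hNXX : N ≤ XX + 1 := by
    have : (N : ℝ) < XX + 2 := by linarith
    have : (N : ℝ) < ((XX + 2 : ℕ) : ℝ) := by push_cast; exact this
    have := Nat.cast_lt.mp this
    omega
  have hXN : XX ≤ N * N := by
    have h : (XX : ℝ) ≤ (N : ℝ) * N := by nlinarith
    exact_mod_cast h
  -- the rough numbers versus the primes
  have h1 := abs_card_filter_sub_le_abs_add_two (q := q) hXN c c'
  have hTc := card_primes_Icc_filter_add (q := q) (c := c) hN1 hNXX
  have hTc' := card_primes_Icc_filter_add (q := q) (c := c') hN1 hNXX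
  have eT : (#(((Icc N XX).filter Nat.Prime).filter (· ≡ c [MOD q])) : ℝ) -
      #(((Icc N XX).filter Nat.Prime).filter (· ≡ c' [MOD q])) =
      ((ParityWave0.primeCountingMod q c XX : ℝ) - ParityWave0.primeCountingMod q c' XX) -
        ((ParityWave0.primeCountingMod q c (N - 1) : ℝ) -
          ParityWave0.primeCountingMod q c' (N - 1)) := by
    have e1 : (#(((Icc N XX).filter Nat.Prime).filter (· ≡ c [MOD q])) : ℝ) =
        (ParityWave0.primeCountingMod q c XX : ℝ) - ParityWave0.primeCountingMod q c (N - 1) := by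
      rw [← hTc]; push_cast; ring
    have e2 : (#(((Icc N XX).filter Nat.Prime).filter (· ≡ c' [MOD q])) : ℝ) =
        (ParityWave0.primeCountingMod q c' XX : ℝ) - ParityWave0.primeCountingMod q c' (N - 1) := by
      rw [← hTc']; push_cast; ring
    rw [e1, e2]; ring
  -- the prime number theorem in the two classes, at `XX` and at `N - 1`
  have hXXn : n₀ ≤ XX := by omega
  have hN1n : n₀ ≤ N - 1 := by omega
  have hPX := hn₀ XX hXXn c c' hc hc'
  have hPN := hn₀ (N - 1) hN1n c c' hc hc'
  -- sizes: `XX/log XX ≤ X/log Y`, `(N-1)/log (N-1) ≤ X/log Y`, `2 ≤ (ε/2) X/log Y`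
  have hXX3 : (3 : ℝ) ≤ XX := by
    have : 3 ≤ XX := by omega
    exact_mod_cast this
  have heXX : Real.exp 1 ≤ (XX : ℝ) := by have := Real.exp_one_lt_d9; linarith
  have hb1 : (XX : ℝ) / Real.log XX ≤ X / Real.log Y :=
    (hmono _ _ heXX hXXX).trans
      (div_le_div_of_nonneg_left hx0.le hly (Real.log_le_log hy0 hYX))
  have hN1R : ((N - 1 : ℕ) : ℝ) = (N : ℝ) - 1 := by
    rw [Nat.cast_sub hN1, Nat.cast_one]
  have hb2 : ((N - 1 : ℕ) : ℝ) / Real.log ((N - 1 : ℕ) : ℝ) ≤ X / Real.log Y := by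
    rw [hN1R]
    have he : Real.exp 1 ≤ (N : ℝ) - 1 := by
      have := Real.exp_one_lt_d9; linarith
    calc ((N : ℝ) - 1) / Real.log ((N : ℝ) - 1) ≤ Y / Real.log Y :=
          hmono _ _ he (by linarith)
      _ ≤ X / Real.log Y := div_le_div_of_nonneg_right hYX hly.le
  have hb3 : 2 ≤ ε / 2 * (X / Real.log Y) := by
    have hlogY : Real.log Y ≤ ε / 4 * Y := ht₁ Y hYt
    have h4 : 4 / ε ≤ Y / Real.log Y := by
      rw [div_le_div_iff₀ hε hly]; linarith
    have h5 : Y / Real.log Y ≤ X / Real.log Y := div_le_div_of_nonneg_right hYX hly.le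
    have h6 : 4 / ε ≤ X / Real.log Y := h4.trans h5
    have hε0 : ε ≠ 0 := hε.ne'
    calc (2 : ℝ) = ε / 2 * (4 / ε) := by field_simp; norm_num
      _ ≤ ε / 2 * (X / Real.log Y) := mul_le_mul_of_nonneg_left h6 (by positivity)
  -- assembly
  rw [eT] at h1
  have hA : |((ParityWave0.primeCountingMod q c XX : ℝ) - ParityWave0.primeCountingMod q c' XX) -
      ((ParityWave0.primeCountingMod q c (N - 1) : ℝ) - ParityWave0.primeCountingMod q c' (N - 1))|
      ≤ ε / 4 * (X / Real.log Y) + ε / 4 * (X / Real.log Y) := by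
    refine (abs_sub _ _).trans (add_le_add (hPX.trans ?_) (hPN.trans ?_))
    · rw [mul_div_assoc]; exact mul_le_mul_of_nonneg_left hb1 (by positivity)
    · rw [mul_div_assoc]; exact mul_le_mul_of_nonneg_left hb2 (by positivity)
  calc _ ≤ ε / 4 * (X / Real.log Y) + ε / 4 * (X / Real.log Y) + 2 := by linarith
    _ ≤ ε / 4 * (X / Real.log Y) + ε / 4 * (X / Real.log Y) + ε / 2 * (X / Real.log Y) := by
        linarith
    _ = ε * X / Real.log Y := by ring

end RoughAP

end Literature.NumberTheory.Sieve
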